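import Summits.CriticalPhenomena.Ising3D.Control2DOpeEpsCells
import Summits.CriticalPhenomena.Ising3D.Control2DL15OpeELBData28
import Summits.CriticalPhenomena.Ising3D.Control2DL15OpeELBData29
import Summits.CriticalPhenomena.Ising3D.Control2DL15OpeELBData30
import Summits.CriticalPhenomena.Ising3D.Control2DL15OpeELBData31
import Summits.CriticalPhenomena.Ising3D.Control2DL15OpeELBData32
import Summits.CriticalPhenomena.Ising3D.Control2DL15OpeELBData33
import Summits.CriticalPhenomena.Ising3D.Control2DL15OpeELBData34
import Summits.CriticalPhenomena.Ising3D.Control2DL15OpeELBData35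
import Summits.CriticalPhenomena.Ising3D.Control2DL15OpeELBRegion
import Summits.CriticalPhenomena.Ising3D.Control2DOpeEpsKernelSharp
import Summits.CriticalPhenomena.Ising3D.Control2DOpeEpsKernelZ
import Mathlib.Tactic.IntervalCases
import Mathlib.Tactic.Linarith
import Mathlib.Tactic.NormNum
import HarnessLib

/-!
# A kind-`ope2eps` (sense LOWER) 2D γ-certificate in the kernel: `W(box) > 15621/250000` at `Δ_σ = 1/8` under `A2D′` (Λ = 15)
(cell `pub-ising3x`, seats controls-1 gen 21 / gen 25 (LOWER box leaf via `epsSignLowerB_of_bernAuto_truncZ`); KERNEL PATH for the 2D γ-certificates, kind `ope2eps` (the λ²_σσε datum) — CONTROL-ONLY)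

HONEST FRAMING: lottery ticket; floor = tightest certified 3D Ising CFT bounds; no exact-solution
claim without a proof. CONTROL-ONLY: `d = 2`, global blocks, `Δ_σ = 1/8` exact, the 2D axiom set `A2D′` with the
CERTIFIED `ε` box `[197/200, 20001/20000]` as scalar input; `W = Σ_(ℓ=0, Δ_i in the box) p_i 2^(-Δ_i)` is the weighted in-box scalar content
(`Control2DOpeEpsTwoSided`; `pBoxTwoSided_rb6_L15` turns the (lower, upper) pair into two-sided bounds on `p_box` and `λ²_σσ[box] = 2 p_box`).

**`opeEpsLower_2d_L15_opeELB : OpeEpsLowerA2D (1/8) 2 1 (197 / 200) (20001 / 20000) (15621/250000)`** — from the RB-6 ope2eps (sense lower) certificate `j140872_functional_deriv2d_L15_E040_sig1o8_ope2epslower_P15621o250000.json` (Λ = 15, E₀ = 40): W(box) > 15621/250000 at Δ_σ = 1/8 under A2D′, W = Σ_(ℓ=0, Δ ∈ [197/200, 20001/20000]) p_i 2^(-Δ_i) (⇒ λ²_σσ[box] > 2·2^(197/200)·15621/250000), with EVERY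
obligation re-decided in the Lean kernel: per box cell (I″) and the SIGN of the truncated scalar block plus the SHARP integer double-series tail majorant (`Control2DOpeEpsTailSharp`, uniform margin `epsLowerMarginB`)
as Bernstein decisions on the spin-0 literal (`epsChk*_opeELB_l*`, `Control2DOpeEpsKernel`), (R) by `region_of_kernelCertAuto`, cells `cells_opeELB`
(`OpeEpsCellsN`: (C′), the stress-tensor point, spin 2 on [3, E₀), even spins ≥ 4). Zero grant compute. No facts, standard axioms only.

`cells_opeELB`: every cell obligation of the certificate ((E) on the ε box, (C′) scalars on [2, E₀), the stress-tensor point (T), spin 2 on [3, E₀), even spins ≥ 4 on [ℓ, E₀); E₀ = 40), in the witness form `∃ N ≥ E₀` with the spin's own truncation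
order, from the kernel-decided Bernstein leaves of `Control2DL15OpeELBData*` via `cell_nonneg_of_bernCheck` (leaves of the extra leaf files are decided on the GROUP-SUM form `phat…g<i>` of the cell polynomial; each such application bridges `phat… = phat…g<i>` by an inline `decide +kernel` — controls-1 g20, one gate dependency level less). No facts, standard axioms only.

ONE MODULE for the cells theorem and the assembly (controls-1 g20): every gate dependency level waits for the farm's tree build to catch
up with the freshly landed imports (measured 1–2 h per level under load, `remote:stale:…:unbuilt`), so the cells theorem below is not a
separate `…Cells` module as in the earlier replays; statements and proofs are unchanged.
controls-1 g25 (2): the 3 inline group-sum bridges of spin 0 are proved ONCE as the in-file theorem `phatopeELBs0_eq_g2`.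
controls-1 g26: `cells_opeELB` is a `have` inside `opeEpsLower_2d_L15_opeELB` (gate statement-dedup between the two senses' cells theorems); exported statements unchanged.
-/

namespace Summit.CriticalPhenomena.Ising3D.Control2D

open Finset Set
open Literature.MathematicalPhysics.QuantumFieldTheory.ConformalBootstrap3D

set_option maxHeartbeats 0 in
/-- Group-sum bridge (controls-1 g25: proved ONCE here; each inline occurrence was a separate ≈ 20–55 s kernel check). [folklore] -/
theorem phatopeELBs0_eq_g2 : phatopeELBs0 = phatopeELBs0g2 := by decide +kernel

-- controls-1 g26: `cells_opeELB` is proved INLINE inside `opeEpsLower_2d_L15_opeELB` (`have`): as a top-level theorem its statement differs from the other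
-- sense's cells theorem only by the weight table inside `fun p => (wt p : ℝ)`, which the gate's statement-dedup normaliser identifies (`dedup.landed`).
set_option maxHeartbeats 0 in
set_option maxRecDepth 200000 in
/-- **2D control, γ-architecture, kind `ope2eps` (LOWER sense), kernel-complete: under `A2D′` at `Δ_σ = 1/8` with the `ε` box
`[197/200, 20001/20000]`, `W(box) > 15621/250000`**, every obligation of the Λ = 15 functional checked in the Lean kernel (scalar-block truncation
`N = 79 + 1` on the box, SHARP integer double-series tail). CONTROL-ONLY (d = 2). [cite: RattazziEtAl2008, §5.5] -/
theorem opeEpsLower_2d_L15_opeELB : OpeEpsLowerA2D (1 / 8 : ℝ) 2 1 (197 / 200) (20001 / 20000) (15621 / 250000) := by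
  have cells_opeELB : OpeEpsCellsN slL15.toFinset (fun p => (wtopeELB p : ℝ)) (1 / 8) 2 1 40 := by
    refine ⟨?_, ?_, ?_, ?_⟩
    · intro Δ h1 h2
      replace h2 := h2.le
      refine ⟨79 + 1, by norm_num, ?_⟩
      rcases le_or_gt Δ ((51 : ℝ) / 16) with hd0 | hd0
      · exact cell_nonneg_of_bernAuto_trunc wtopeELB slL15_nodup slL15_deg 0 79 549 (q := 32) (a := 32) (L := 19) (by norm_num) (by norm_num) (by norm_num) (by rw [phatopeELBs0_eq]; exact cellChk_opeELB_s0l0) (by norm_num; linarith) (by norm_num; linarith)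
      rcases le_or_gt Δ ((121 : ℝ) / 32) with hd1 | hd1
      · exact cell_nonneg_of_bernAuto_trunc wtopeELB slL15_nodup slL15_deg 0 79 549 (q := 64) (a := 102) (L := 19) (by norm_num) (by norm_num) (by norm_num) (by rw [phatopeELBs0_eq]; exact cellChk_opeELB_s0l1) (by norm_num; linarith) (by norm_num; linarith)
      rcases le_or_gt Δ ((261 : ℝ) / 64) with hd2 | hd2
      · exact cell_nonneg_of_bernAuto_trunc wtopeELB slL15_nodup slL15_deg 0 79 549 (q := 128) (a := 242) (L := 19) (by norm_num) (by norm_num) (by norm_num) (by rw [phatopeELBs0_eq]; exact cellChk_opeELB_s0l2) (by norm_num; linarith) (by norm_num; linarith)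
      rcases le_or_gt Δ ((35 : ℝ) / 8) with hd3 | hd3
      · exact cell_nonneg_of_bernAuto_trunc wtopeELB slL15_nodup slL15_deg 0 79 549 (q := 128) (a := 261) (L := 19) (by norm_num) (by norm_num) (by norm_num) (by rw [phatopeELBs0_eq]; exact cellChk_opeELB_s0l3) (by norm_num; linarith) (by norm_num; linarith)
      rcases le_or_gt Δ ((27 : ℝ) / 4) with hd4 | hd4
      · exact cell_nonneg_of_bernAuto_trunc wtopeELB slL15_nodup slL15_deg 0 79 549 (q := 16) (a := 35) (L := 19) (by norm_num) (by norm_num) (by norm_num) (by rw [phatopeELBs0_eq]; exact cellChk_opeELB_s0l4) (by norm_num; linarith) (by norm_num; linarith)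
      rcases le_or_gt Δ ((23 : ℝ) / 2) with hd5 | hd5
      · exact cell_nonneg_of_bernAuto_trunc wtopeELB slL15_nodup slL15_deg 0 79 549 (q := 8) (a := 27) (L := 19) (by norm_num) (by norm_num) (by norm_num) (by rw [phatopeELBs0_eq]; exact cellChk_opeELB_s0l5) (by norm_num; linarith) (by norm_num; linarith)
      rcases le_or_gt Δ (21 : ℝ) with hd6 | hd6
      · exact cell_nonneg_of_bernAuto_trunc wtopeELB slL15_nodup slL15_deg 0 79 549 (q := 4) (a := 23) (L := 19) (by norm_num) (by norm_num) (by norm_num) (by rw [phatopeELBs0_eq]; exact cellChk_opeELB_s0l6) (by norm_num; linarith) (by norm_num; linarith)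
      exact cell_nonneg_of_bernAuto_trunc wtopeELB slL15_nodup slL15_deg 0 79 549 (q := 2) (a := 21) (L := 19) (by norm_num) (by norm_num) (by norm_num) (by rw [phatopeELBs0_eq, phatopeELBs0_eq_g2]; exact cellChk_opeELB_s0l7) (by norm_num; linarith) (by norm_num; linarith)
    · refine ⟨47 + 1, by norm_num, ?_⟩
      exact cell_nonneg_of_bernAuto_trunc wtopeELB slL15_nodup slL15_deg 2 47 305 (q := 1) (a := 0) (L := 0) (by norm_num) (by norm_num) (by norm_num) (by rw [phatopeELBs2_eq]; exact cellChk_opeELB_s2l0) (by norm_num) (by norm_num)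
    · intro Δ h1 h2
      replace h1 : (3 : ℝ) ≤ Δ := by linarith
      replace h2 := h2.le
      refine ⟨47 + 1, by norm_num, ?_⟩
      rcases le_or_gt Δ ((85 : ℝ) / 16) with hd0 | hd0
      · exact cell_nonneg_of_bernAuto_trunc wtopeELB slL15_nodup slL15_deg 2 47 305 (q := 32) (a := 16) (L := 37) (by norm_num) (by norm_num) (by norm_num) (by rw [phatopeELBs2_eq]; exact cellChk_opeELB_s2l1) (by norm_num; linarith) (by norm_num; linarith)
      rcases le_or_gt Δ ((377 : ℝ) / 64) with hd1 | hd1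
      · exact cell_nonneg_of_bernAuto_trunc wtopeELB slL15_nodup slL15_deg 2 47 305 (q := 128) (a := 212) (L := 37) (by norm_num) (by norm_num) (by norm_num) (by rw [phatopeELBs2_eq]; exact cellChk_opeELB_s2l2) (by norm_num; linarith) (by norm_num; linarith)
      rcases le_or_gt Δ ((207 : ℝ) / 32) with hd2 | hd2
      · exact cell_nonneg_of_bernAuto_trunc wtopeELB slL15_nodup slL15_deg 2 47 305 (q := 128) (a := 249) (L := 37) (by norm_num) (by norm_num) (by norm_num) (by rw [phatopeELBs2_eq]; exact cellChk_opeELB_s2l3) (by norm_num; linarith) (by norm_num; linarith)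
      rcases le_or_gt Δ ((61 : ℝ) / 8) with hd3 | hd3
      · exact cell_nonneg_of_bernAuto_trunc wtopeELB slL15_nodup slL15_deg 2 47 305 (q := 64) (a := 143) (L := 37) (by norm_num) (by norm_num) (by norm_num) (by rw [phatopeELBs2_eq]; exact cellChk_opeELB_s2l4) (by norm_num; linarith) (by norm_num; linarith)
      rcases le_or_gt Δ ((281 : ℝ) / 32) with hd4 | hd4
      · exact cell_nonneg_of_bernAuto_trunc wtopeELB slL15_nodup slL15_deg 2 47 305 (q := 64) (a := 180) (L := 37) (by norm_num) (by norm_num) (by norm_num) (by rw [phatopeELBs2_eq]; exact cellChk_opeELB_s2l5) (by norm_num; linarith) (by norm_num; linarith)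
      rcases le_or_gt Δ ((159 : ℝ) / 16) with hd5 | hd5
      · exact cell_nonneg_of_bernAuto_trunc wtopeELB slL15_nodup slL15_deg 2 47 305 (q := 64) (a := 217) (L := 37) (by norm_num) (by norm_num) (by norm_num) (by rw [phatopeELBs2_eq]; exact cellChk_opeELB_s2l6) (by norm_num; linarith) (by norm_num; linarith)
      rcases le_or_gt Δ ((49 : ℝ) / 4) with hd6 | hd6
      · exact cell_nonneg_of_bernAuto_trunc wtopeELB slL15_nodup slL15_deg 2 47 305 (q := 32) (a := 127) (L := 37) (by norm_num) (by norm_num) (by norm_num) (by rw [phatopeELBs2_eq]; exact cellChk_opeELB_s2l7) (by norm_num; linarith) (by norm_num; linarith)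
      rcases le_or_gt Δ ((43 : ℝ) / 2) with hd7 | hd7
      · exact cell_nonneg_of_bernAuto_trunc wtopeELB slL15_nodup slL15_deg 2 47 305 (q := 8) (a := 41) (L := 37) (by norm_num) (by norm_num) (by norm_num) (by rw [phatopeELBs2_eq]; exact cellChk_opeELB_s2l8) (by norm_num; linarith) (by norm_num; linarith)
      exact cell_nonneg_of_bernAuto_trunc wtopeELB slL15_nodup slL15_deg 2 47 305 (q := 4) (a := 39) (L := 37) (by norm_num) (by norm_num) (by norm_num) (by rw [phatopeELBs2_eq]; exact cellChk_opeELB_s2l9) (by norm_num; linarith) (by norm_num; linarith)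
    · intro ℓ hℓ hℓ0 hℓ2 Δ hℓΔ hΔ
      have hℓR : (ℓ : ℝ) < 40 := lt_of_le_of_lt hℓΔ hΔ
      have hℓE : ℓ < 40 := by exact_mod_cast hℓR
      replace h2 := hΔ.le
      interval_cases ℓ
      · exact absurd rfl hℓ0
      · exact absurd hℓ (by decide)
      · exact absurd rfl hℓ2
      · exact absurd hℓ (by decide)
      · have h1 : (4 : ℝ) ≤ Δ := by exact_mod_cast hℓΔ
        refine ⟨39 + 1, by norm_num, ?_⟩
        rcases le_or_gt Δ ((41 : ℝ) / 8) with hd0 | hd0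
        · exact cell_nonneg_of_bernAuto_trunc wtopeELB slL15_nodup slL15_deg 4 39 250 (q := 16) (a := 0) (L := 9) (by norm_num) (by norm_num) (by norm_num) (by rw [phatopeELBs4_eq]; exact cellChk_opeELB_s4l0) (by norm_num; linarith) (by norm_num; linarith)
        rcases le_or_gt Δ ((25 : ℝ) / 4) with hd1 | hd1
        · exact cell_nonneg_of_bernAuto_trunc wtopeELB slL15_nodup slL15_deg 4 39 250 (q := 16) (a := 9) (L := 9) (by norm_num) (by norm_num) (by norm_num) (by rw [phatopeELBs4_eq]; exact cellChk_opeELB_s4l1) (by norm_num; linarith) (by norm_num; linarith)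
        rcases le_or_gt Δ ((59 : ℝ) / 8) with hd2 | hd2
        · exact cell_nonneg_of_bernAuto_trunc wtopeELB slL15_nodup slL15_deg 4 39 250 (q := 16) (a := 18) (L := 9) (by norm_num) (by norm_num) (by norm_num) (by rw [phatopeELBs4_eq]; exact cellChk_opeELB_s4l2) (by norm_num; linarith) (by norm_num; linarith)
        rcases le_or_gt Δ ((245 : ℝ) / 32) with hd3 | hd3
        · exact cell_nonneg_of_bernAuto_trunc wtopeELB slL15_nodup slL15_deg 4 39 250 (q := 64) (a := 108) (L := 9) (by norm_num) (by norm_num) (by norm_num) (by rw [phatopeELBs4_eq]; exact cellChk_opeELB_s4l3) (by norm_num; linarith) (by norm_num; linarith)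
        rcases le_or_gt Δ ((127 : ℝ) / 16) with hd4 | hd4
        · exact cell_nonneg_of_bernAuto_trunc wtopeELB slL15_nodup slL15_deg 4 39 250 (q := 64) (a := 117) (L := 9) (by norm_num) (by norm_num) (by norm_num) (by rw [phatopeELBs4_eq]; exact cellChk_opeELB_s4l4) (by norm_num; linarith) (by norm_num; linarith)
        rcases le_or_gt Δ ((17 : ℝ) / 2) with hd5 | hd5
        · exact cell_nonneg_of_bernAuto_trunc wtopeELB slL15_nodup slL15_deg 4 39 250 (q := 32) (a := 63) (L := 9) (by norm_num) (by norm_num) (by norm_num) (by rw [phatopeELBs4_eq]; exact cellChk_opeELB_s4l5) (by norm_num; linarith) (by norm_num; linarith)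
        rcases le_or_gt Δ (13 : ℝ) with hd6 | hd6
        · exact cell_nonneg_of_bernAuto_trunc wtopeELB slL15_nodup slL15_deg 4 39 250 (q := 4) (a := 9) (L := 9) (by norm_num) (by norm_num) (by norm_num) (by rw [phatopeELBs4_eq]; exact cellChk_opeELB_s4l6) (by norm_num; linarith) (by norm_num; linarith)
        rcases le_or_gt Δ (22 : ℝ) with hd7 | hd7
        · exact cell_nonneg_of_bernAuto_trunc wtopeELB slL15_nodup slL15_deg 4 39 250 (q := 2) (a := 9) (L := 9) (by norm_num) (by norm_num) (by norm_num) (by rw [phatopeELBs4_eq]; exact cellChk_opeELB_s4l7) (by norm_num; linarith) (by norm_num; linarith)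
        exact cell_nonneg_of_bernAuto_trunc wtopeELB slL15_nodup slL15_deg 4 39 250 (q := 1) (a := 9) (L := 9) (by norm_num) (by norm_num) (by norm_num) (by rw [phatopeELBs4_eq]; exact cellChk_opeELB_s4l8) (by norm_num; linarith) (by norm_num; linarith)
      · exact absurd hℓ (by decide)
      · have h1 : (6 : ℝ) ≤ Δ := by exact_mod_cast hℓΔ
        refine ⟨39 + 1, by norm_num, ?_⟩
        rcases le_or_gt Δ ((113 : ℝ) / 16) with hd0 | hd0
        · exact cell_nonneg_of_bernAuto_trunc wtopeELB slL15_nodup slL15_deg 6 39 255 (q := 32) (a := 0) (L := 17) (by norm_num) (by norm_num) (by norm_num) (by rw [phatopeELBs6_eq]; exact cellChk_opeELB_s6l0) (by norm_num; linarith) (by norm_num; linarith)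
        rcases le_or_gt Δ ((65 : ℝ) / 8) with hd1 | hd1
        · exact cell_nonneg_of_bernAuto_trunc wtopeELB slL15_nodup slL15_deg 6 39 255 (q := 32) (a := 17) (L := 17) (by norm_num) (by norm_num) (by norm_num) (by rw [phatopeELBs6_eq]; exact cellChk_opeELB_s6l1) (by norm_num; linarith) (by norm_num; linarith)
        rcases le_or_gt Δ ((41 : ℝ) / 4) with hd2 | hd2
        · exact cell_nonneg_of_bernAuto_trunc wtopeELB slL15_nodup slL15_deg 6 39 255 (q := 16) (a := 17) (L := 17) (by norm_num) (by norm_num) (by norm_num) (by rw [phatopeELBs6_eq]; exact cellChk_opeELB_s6l2) (by norm_num; linarith) (by norm_num; linarith)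
        rcases le_or_gt Δ ((29 : ℝ) / 2) with hd3 | hd3
        · exact cell_nonneg_of_bernAuto_trunc wtopeELB slL15_nodup slL15_deg 6 39 255 (q := 8) (a := 17) (L := 17) (by norm_num) (by norm_num) (by norm_num) (by rw [phatopeELBs6_eq]; exact cellChk_opeELB_s6l3) (by norm_num; linarith) (by norm_num; linarith)
        rcases le_or_gt Δ (23 : ℝ) with hd4 | hd4
        · exact cell_nonneg_of_bernAuto_trunc wtopeELB slL15_nodup slL15_deg 6 39 255 (q := 4) (a := 17) (L := 17) (by norm_num) (by norm_num) (by norm_num) (by rw [phatopeELBs6_eq]; exact cellChk_opeELB_s6l4) (by norm_num; linarith) (by norm_num; linarith)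
        exact cell_nonneg_of_bernAuto_trunc wtopeELB slL15_nodup slL15_deg 6 39 255 (q := 2) (a := 17) (L := 17) (by norm_num) (by norm_num) (by norm_num) (by rw [phatopeELBs6_eq]; exact cellChk_opeELB_s6l5) (by norm_num; linarith) (by norm_num; linarith)
      · exact absurd hℓ (by decide)
      · have h1 : (8 : ℝ) ≤ Δ := by exact_mod_cast hℓΔ
        refine ⟨39 + 1, by norm_num, ?_⟩
        rcases le_or_gt Δ (24 : ℝ) with hd0 | hd0
        · exact cell_nonneg_of_bernAuto_trunc wtopeELB slL15_nodup slL15_deg 8 39 258 (q := 1) (a := 0) (L := 8) (by norm_num) (by norm_num) (by norm_num) (by rw [phatopeELBs8_eq]; exact cellChk_opeELB_s8l0) (by norm_num; linarith) (by norm_num; linarith)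
        exact cell_nonneg_of_bernAuto_trunc wtopeELB slL15_nodup slL15_deg 8 39 258 (q := 1) (a := 8) (L := 8) (by norm_num) (by norm_num) (by norm_num) (by rw [phatopeELBs8_eq]; exact cellChk_opeELB_s8l1) (by norm_num; linarith) (by norm_num; linarith)
      · exact absurd hℓ (by decide)
      · have h1 : (10 : ℝ) ≤ Δ := by exact_mod_cast hℓΔ
        refine ⟨39 + 1, by norm_num, ?_⟩
        rcases le_or_gt Δ ((175 : ℝ) / 16) with hd0 | hd0
        · exact cell_nonneg_of_bernAuto_trunc wtopeELB slL15_nodup slL15_deg 10 39 261 (q := 32) (a := 0) (L := 15) (by norm_num) (by norm_num) (by norm_num) (by rw [phatopeELBs10_eq]; exact cellChk_opeELB_s10l0) (by norm_num; linarith) (by norm_num; linarith)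
        rcases le_or_gt Δ ((95 : ℝ) / 8) with hd1 | hd1
        · exact cell_nonneg_of_bernAuto_trunc wtopeELB slL15_nodup slL15_deg 10 39 261 (q := 32) (a := 15) (L := 15) (by norm_num) (by norm_num) (by norm_num) (by rw [phatopeELBs10_eq]; exact cellChk_opeELB_s10l1) (by norm_num; linarith) (by norm_num; linarith)
        rcases le_or_gt Δ ((55 : ℝ) / 4) with hd2 | hd2
        · exact cell_nonneg_of_bernAuto_trunc wtopeELB slL15_nodup slL15_deg 10 39 261 (q := 16) (a := 15) (L := 15) (by norm_num) (by norm_num) (by norm_num) (by rw [phatopeELBs10_eq]; exact cellChk_opeELB_s10l2) (by norm_num; linarith) (by norm_num; linarith)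
        rcases le_or_gt Δ ((35 : ℝ) / 2) with hd3 | hd3
        · exact cell_nonneg_of_bernAuto_trunc wtopeELB slL15_nodup slL15_deg 10 39 261 (q := 8) (a := 15) (L := 15) (by norm_num) (by norm_num) (by norm_num) (by rw [phatopeELBs10_eq]; exact cellChk_opeELB_s10l3) (by norm_num; linarith) (by norm_num; linarith)
        rcases le_or_gt Δ (25 : ℝ) with hd4 | hd4
        · exact cell_nonneg_of_bernAuto_trunc wtopeELB slL15_nodup slL15_deg 10 39 261 (q := 4) (a := 15) (L := 15) (by norm_num) (by norm_num) (by norm_num) (by rw [phatopeELBs10_eq]; exact cellChk_opeELB_s10l4) (by norm_num; linarith) (by norm_num; linarith)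
        exact cell_nonneg_of_bernAuto_trunc wtopeELB slL15_nodup slL15_deg 10 39 261 (q := 2) (a := 15) (L := 15) (by norm_num) (by norm_num) (by norm_num) (by rw [phatopeELBs10_eq]; exact cellChk_opeELB_s10l5) (by norm_num; linarith) (by norm_num; linarith)
      · exact absurd hℓ (by decide)
      · have h1 : (12 : ℝ) ≤ Δ := by exact_mod_cast hℓΔ
        refine ⟨39 + 1, by norm_num, ?_⟩
        rcases le_or_gt Δ (19 : ℝ) with hd0 | hd0
        · exact cell_nonneg_of_bernAuto_trunc wtopeELB slL15_nodup slL15_deg 12 39 263 (q := 2) (a := 0) (L := 7) (by norm_num) (by norm_num) (by norm_num) (by rw [phatopeELBs12_eq]; exact cellChk_opeELB_s12l0) (by norm_num; linarith) (by norm_num; linarith)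
        rcases le_or_gt Δ (26 : ℝ) with hd1 | hd1
        · exact cell_nonneg_of_bernAuto_trunc wtopeELB slL15_nodup slL15_deg 12 39 263 (q := 2) (a := 7) (L := 7) (by norm_num) (by norm_num) (by norm_num) (by rw [phatopeELBs12_eq]; exact cellChk_opeELB_s12l1) (by norm_num; linarith) (by norm_num; linarith)
        exact cell_nonneg_of_bernAuto_trunc wtopeELB slL15_nodup slL15_deg 12 39 263 (q := 1) (a := 7) (L := 7) (by norm_num) (by norm_num) (by norm_num) (by rw [phatopeELBs12_eq]; exact cellChk_opeELB_s12l2) (by norm_num; linarith) (by norm_num; linarith)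
      · exact absurd hℓ (by decide)
      · have h1 : (14 : ℝ) ≤ Δ := by exact_mod_cast hℓΔ
        refine ⟨39 + 1, by norm_num, ?_⟩
        exact cell_nonneg_of_bernAuto_trunc wtopeELB slL15_nodup slL15_deg 14 39 265 (q := 1) (a := 0) (L := 13) (by norm_num) (by norm_num) (by norm_num) (by rw [phatopeELBs14_eq]; exact cellChk_opeELB_s14l0) (by norm_num; linarith) (by norm_num; linarith)
      · exact absurd hℓ (by decide)
      · have h1 : (16 : ℝ) ≤ Δ := by exact_mod_cast hℓΔ
        refine ⟨39 + 1, by norm_num, ?_⟩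
        exact cell_nonneg_of_bernAuto_trunc wtopeELB slL15_nodup slL15_deg 16 39 268 (q := 1) (a := 0) (L := 12) (by norm_num) (by norm_num) (by norm_num) (by rw [phatopeELBs16_eq]; exact cellChk_opeELB_s16l0) (by norm_num; linarith) (by norm_num; linarith)
      · exact absurd hℓ (by decide)
      · have h1 : (18 : ℝ) ≤ Δ := by exact_mod_cast hℓΔ
        refine ⟨39 + 1, by norm_num, ?_⟩
        exact cell_nonneg_of_bernAuto_trunc wtopeELB slL15_nodup slL15_deg 18 39 270 (q := 1) (a := 0) (L := 11) (by norm_num) (by norm_num) (by norm_num) (by rw [phatopeELBs18_eq]; exact cellChk_opeELB_s18l0) (by norm_num; linarith) (by norm_num; linarith)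
      · exact absurd hℓ (by decide)
      · have h1 : (20 : ℝ) ≤ Δ := by exact_mod_cast hℓΔ
        refine ⟨39 + 1, by norm_num, ?_⟩
        exact cell_nonneg_of_bernAuto_trunc wtopeELB slL15_nodup slL15_deg 20 39 272 (q := 1) (a := 0) (L := 10) (by norm_num) (by norm_num) (by norm_num) (by rw [phatopeELBs20_eq]; exact cellChk_opeELB_s20l0) (by norm_num; linarith) (by norm_num; linarith)
      · exact absurd hℓ (by decide)
      · have h1 : (22 : ℝ) ≤ Δ := by exact_mod_cast hℓΔ
        refine ⟨39 + 1, by norm_num, ?_⟩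
        exact cell_nonneg_of_bernAuto_trunc wtopeELB slL15_nodup slL15_deg 22 39 274 (q := 1) (a := 0) (L := 9) (by norm_num) (by norm_num) (by norm_num) (by rw [phatopeELBs22_eq]; exact cellChk_opeELB_s22l0) (by norm_num; linarith) (by norm_num; linarith)
      · exact absurd hℓ (by decide)
      · have h1 : (24 : ℝ) ≤ Δ := by exact_mod_cast hℓΔ
        refine ⟨39 + 1, by norm_num, ?_⟩
        exact cell_nonneg_of_bernAuto_trunc wtopeELB slL15_nodup slL15_deg 24 39 276 (q := 1) (a := 0) (L := 8) (by norm_num) (by norm_num) (by norm_num) (by rw [phatopeELBs24_eq]; exact cellChk_opeELB_s24l0) (by norm_num; linarith) (by norm_num; linarith)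
      · exact absurd hℓ (by decide)
      · have h1 : (26 : ℝ) ≤ Δ := by exact_mod_cast hℓΔ
        refine ⟨39 + 1, by norm_num, ?_⟩
        exact cell_nonneg_of_bernAuto_trunc wtopeELB slL15_nodup slL15_deg 26 39 278 (q := 1) (a := 0) (L := 7) (by norm_num) (by norm_num) (by norm_num) (by rw [phatopeELBs26_eq]; exact cellChk_opeELB_s26l0) (by norm_num; linarith) (by norm_num; linarith)
      · exact absurd hℓ (by decide)
      · have h1 : (28 : ℝ) ≤ Δ := by exact_mod_cast hℓΔ
        refine ⟨39 + 1, by norm_num, ?_⟩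
        exact cell_nonneg_of_bernAuto_trunc wtopeELB slL15_nodup slL15_deg 28 39 279 (q := 1) (a := 0) (L := 6) (by norm_num) (by norm_num) (by norm_num) (by rw [phatopeELBs28_eq]; exact cellChk_opeELB_s28l0) (by norm_num; linarith) (by norm_num; linarith)
      · exact absurd hℓ (by decide)
      · have h1 : (30 : ℝ) ≤ Δ := by exact_mod_cast hℓΔ
        refine ⟨39 + 1, by norm_num, ?_⟩
        exact cell_nonneg_of_bernAuto_trunc wtopeELB slL15_nodup slL15_deg 30 39 281 (q := 1) (a := 0) (L := 5) (by norm_num) (by norm_num) (by norm_num) (by rw [phatopeELBs30_eq]; exact cellChk_opeELB_s30l0) (by norm_num; linarith) (by norm_num; linarith)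
      · exact absurd hℓ (by decide)
      · have h1 : (32 : ℝ) ≤ Δ := by exact_mod_cast hℓΔ
        refine ⟨39 + 1, by norm_num, ?_⟩
        exact cell_nonneg_of_bernAuto_trunc wtopeELB slL15_nodup slL15_deg 32 39 283 (q := 1) (a := 0) (L := 4) (by norm_num) (by norm_num) (by norm_num) (by rw [phatopeELBs32_eq]; exact cellChk_opeELB_s32l0) (by norm_num; linarith) (by norm_num; linarith)
      · exact absurd hℓ (by decide)
      · have h1 : (34 : ℝ) ≤ Δ := by exact_mod_cast hℓΔ
        refine ⟨39 + 1, by norm_num, ?_⟩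
        exact cell_nonneg_of_bernAuto_trunc wtopeELB slL15_nodup slL15_deg 34 39 284 (q := 1) (a := 0) (L := 3) (by norm_num) (by norm_num) (by norm_num) (by rw [phatopeELBs34_eq]; exact cellChk_opeELB_s34l0) (by norm_num; linarith) (by norm_num; linarith)
      · exact absurd hℓ (by decide)
      · have h1 : (36 : ℝ) ≤ Δ := by exact_mod_cast hℓΔ
        refine ⟨39 + 1, by norm_num, ?_⟩
        exact cell_nonneg_of_bernAuto_trunc wtopeELB slL15_nodup slL15_deg 36 39 285 (q := 1) (a := 0) (L := 2) (by norm_num) (by norm_num) (by norm_num) (by rw [phatopeELBs36_eq]; exact cellChk_opeELB_s36l0) (by norm_num; linarith) (by norm_num; linarith)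
      · exact absurd hℓ (by decide)
      · have h1 : (38 : ℝ) ≤ Δ := by exact_mod_cast hℓΔ
        refine ⟨39 + 1, by norm_num, ?_⟩
        exact cell_nonneg_of_bernAuto_trunc wtopeELB slL15_nodup slL15_deg 38 39 287 (q := 1) (a := 0) (L := 1) (by norm_num) (by norm_num) (by norm_num) (by rw [phatopeELBs38_eq]; exact cellChk_opeELB_s38l0) (by norm_num; linarith) (by norm_num; linarith)
      · exact absurd hℓ (by decide)
  have hΛ : ∀ p ∈ slL15.toFinset, p.1 ≤ 15 ∧ p.2 ≤ 15 := by
    intro p hp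
    have := slL15_deg p (List.mem_toFinset.mp hp)
    exact ⟨by omega, by omega⟩
  have hbox : ∀ Δ : ℝ, (197 / 200 : ℝ) ≤ Δ → Δ ≤ 20001 / 20000 →
      (2 : ℝ) ^ Δ * taylorFunctional2D (1 / 2) slL15.toFinset (fun p => (wtopeELB p : ℝ)) (crossF (1 / 8) (-1) (QN (79 + 1) 0 Δ)) +
          (1 / 2 : ℝ) ^ (1 / 8 : ℝ) * (1 / 2 : ℝ) ^ (1 / 8 : ℝ) * (2 * absWeight slL15.toFinset (fun p => (wtopeELB p : ℝ))) *
            (tailMajorB 15 (79 + 1) * (2 * headMajorB 15 (79 + 1) + tailMajorB 15 (79 + 1))) ≤ -epsLowerMarginB 15 79 (((((19700 : ℤ)) : ℝ) + (((301 : ℤ)) : ℝ)) / (((40000 : ℤ)) : ℝ)) ∧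
      0 < taylorFunctional2D (1 / 2) slL15.toFinset (fun p => (wtopeELB p : ℝ)) (crossF (1 / 8) (-1) (fun _ _ => (1 : ℝ))) +
        (((15621 : ℕ) : ℝ) / ((250000 : ℕ) : ℝ)) * ((2 : ℝ) ^ Δ * taylorFunctional2D (1 / 2) slL15.toFinset (fun p => (wtopeELB p : ℝ)) (crossF (1 / 8) (-1) (QN (79 + 1) 0 Δ))) := by
    intro Δ h1 h2
    refine ⟨?_, ?_⟩
    · exact epsSignLowerB_of_bernAuto_truncZ wtopeELB slL15_nodup slL15_deg 79 600 (by norm_num) (q := 40000) (a := 19700) (L := 301) (by norm_num) (by norm_num) (by norm_num) (by norm_num) (by unfold epsLowerPolyZB; rw [phatopeELBs0_eq, phatopeELBs0_eq_g2]; exact epsChkL_opeELB_l0) (by norm_num; linarith) (by norm_num; linarith)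
    · exact epsIdent_of_bernAuto_trunc wtopeELB slL15_nodup slL15_deg 79 553 (Pn := 15621) (Pd := 250000) (by norm_num) (q := 40000) (a := 19700) (L := 301) (by norm_num) (by norm_num) (by norm_num) (by unfold epsIdentPolyZ; rw [phatopeELBs0_eq, phatopeELBs0_eq_g2]; exact epsChkI_opeELB_l0) (by norm_num; linarith) (by norm_num; linarith)
  have h := opeEpsLower_half_of_cellsN_sharp slL15.toFinset (fun p => (wtopeELB p : ℝ)) (s := 1 / 8) (G := 2) (δ := 1) (E₀ := 40)
    (e₁ := 197 / 200) (e₂ := 20001 / 20000) (N := 79 + 1)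
    (by norm_num) (by norm_num) (by norm_num) (by norm_num) (by norm_num) (by norm_num) (by norm_num) (by norm_num)
    (epsLowerMarginB_pos 15 79 (by norm_num) (by norm_num)) hΛ (by norm_num) (by norm_num) hbox
    (region_of_kernelCertAuto wtopeELB slL15_nodup slL15_deg 15 16 (by norm_num) (by norm_num) PregopeELB_eq
      (by decide +kernel) QhatopeELB_eq _ cregopeELB_n0 cregJopeELB (by decide) cregJopeELB_ok) cells_opeELB
  push_cast at h
  exact h

end Summit.CriticalPhenomena.Ising3D.Control2D
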